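import Literature.Barriers.RiemannHypothesis.EpsteinZetaRealZerosDHShifts
import Literature.Barriers.RiemannHypothesis.EpsteinZetaRealZerosDHClassDensity
import Literature.Barriers.RiemannHypothesis.EpsteinZetaRealZerosDHClassSum
import Literature.Barriers.RiemannHypothesis.EpsteinZetaRealZerosDHEvenTwist
import Mathlib.Analysis.Complex.Trigonometric
import HarnessLib

/-!
# Davenport–Heilbronn for Epstein zeta functions, V: a real zero of the twisted model for a real
# class-group character (Davenport–Heilbronn I, Lemma 2 and Theorem 3 — `h(d)` even)

Sibling of `Literature/Barriers/RiemannHypothesis/EpsteinZetaRealZeros.lean` (named fact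
`DavenportHeilbronn1936b_epstein`). Everything in this file is PROVED; no definitions, no named facts.

Davenport–Heilbronn I, §2 Lemma 1–2 and §4 Theorem 3: with the genus twist `a` of a real
non-principal character `χ₁` of `Cl(K)` (`EpsteinZetaRealZerosDHEvenTwist.lean`), the twisted function

  `Z(s) = ∑_{𝔞 ∈ 𝔎} a(N𝔞) N𝔞^{-s} = (1/h) ∑_χ χ̄(𝔎) M(s, χ)`,  `M(s, χ) = ∏_𝔭 (1 − χ(𝔭) a(N𝔭) N𝔭^{-s})⁻¹`

is real for `s > 1` [up to the constant factor `η ∈ {1, i}`, `η² = χ₁(𝔎)`], and (Lemma 1)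
`log M(s, χ₀) = −½(1+i) log (s−1) + O(1)`, `log M(s, χ₁) = −½(1−i) log (s−1) + O(1)`,
`log M(s, χ) = O(1)` for `χ ≠ χ₀, χ₁`; hence (Lemma 2) "for any `H > 0` we can find `s₁` and `s₂` such
that `1 < s₁ < s₂ < 1 + δ` and `ℜ(M(s₁, χ₀)/a(l)) > H`, `ℜ(M(s₂, χ₀)/a(l)) < −H`. Then, if `H` is
sufficiently large, `Z(s₁) > 0 > Z(s₂)`. Thus there is a value of `s` with `1 < s < 1 + δ` for which
`Z(s) = 0`." Theorem 3 (§4): "`ζ(s, Q)` has an infinity of zeros for `σ > 1`."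

We prove (`exists_real_zero_twistModel_of_real_addChar`): for an imaginary quadratic field `K` with
`d_K < −4`, an integral basis `(1, ω)` (`ω² = m + tω`), the form `Q = (A, t − 2k, C)` of the lattice
ideal `𝔟 = (A, ω − k)` (`A > 0`, `AC = k² − tk − m`), a real non-principal character `χ₁` and a genus
twist `a`, the twisted model `Z_a(s) = Σ'_v a(Q(v)) Q(v)^{-s}` has a real zero `s₁ > 1` (and a real
non-zero `s₂ > 1`). With the analytic half (`davenportHeilbronn_conclusion_of_twist_zero`,
`EpsteinZetaRealZerosDHShifts.lean`) this gives Theorem 3 with Titchmarsh's `≫ T` count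
(`davenportHeilbronn_conclusion_of_real_addChar`): the conclusion of `DavenportHeilbronn1936b_epstein`
for the form `(A, t − 2k, C)`.

Ingredients: the bridge `Z_a(s) = (2/h) ∑_χ χ([𝔟]) exp E_χ(s)` (`twistModel_eq_sum_addChar`), the
conjugation symmetry `conj E_χ = E_{χ₁−χ}` (from `conj ∘ twistCoeff χ a = twistCoeff (χ₁−χ) a` and
`logEuler_conj`), the decomposition of the degree-one part of `E_χ` as
`½(1+i) D_χ + ½(1−i) D_{χ+χ₁}` (`tsum_primeTerm_twistCoeff`) with the limits of `D_χ` at `1⁺`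
(`EpsteinZetaRealZerosDHClassDensity.lean`), and an elementary real-variable lemma
(`exists_zero_of_logOsc`: a continuous real function within bounded distance of
`2 ℜ(e^{iθ} e^{−½(1+i)log(s−1) + F(s)})`, `F → c`, changes sign on `(1, 1+δ)`).

## References

* [DavenportHeilbronn1936a] H. Davenport, H. Heilbronn, *On the zeros of certain Dirichlet series I*,
  J. London Math. Soc. 11 (1936), 181–185, §2 Lemmas 1–2 and §4 Theorem 3.
* [Titchmarsh1986] E. C. Titchmarsh, *The Theory of the Riemann Zeta-Function*, 2nd ed., §10.25
  (the model computation "`N(s) = (s−1)^{-1/2} cos(½ log 1/(s−1)) e^{O(1)}`").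
-/

noncomputable section

open Filter Topology Complex NumberField IsDedekindDomain Module Set
open Literature.NumberTheory.LFunctions Literature.NumberTheory.LFunctions.AbelianDensity
open Literature.NumberTheory.QuadraticFields.Quadratic
open scoped nonZeroDivisors ComplexConjugate Classical

namespace Literature.Barriers.RiemannHypothesis

namespace DHEpstein

/-! ## A real-variable lemma: sign changes of `2 ℜ(e^{iθ} e^{−½(1+i)log(s−1) + F(s)})` -/

/-- `cos x ≥ 7/8` for `|x| ≤ 1/2`. [folklore] -/
theorem cos_ge_of_abs_le_half {x : ℝ} (hx : |x| ≤ 1 / 2) : 7 / 8 ≤ Real.cos x := by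
  have h := Real.one_sub_sq_div_two_le_cos (x := x)
  have hx2 : x ^ 2 ≤ 1 / 4 := by
    have : |x| ^ 2 ≤ (1 / 2) ^ 2 := pow_le_pow_left₀ (abs_nonneg x) hx 2
    rw [sq_abs] at this
    linarith
  linarith

/-- The model term at the point `s = 1 + e^{−2u}`: `ℜ(e^{iθ} e^{−½(1+i)log(s−1) + z}) =
e^{u + ℜ z} cos(θ + u + ℑ z)`. [cite: Titchmarsh1986, §10.25] -/
theorem re_model_at (θ u : ℝ) (z : ℂ) :
    (cexp (θ * I) * cexp (-(1 / 2) * (1 + I) * (Real.log (1 + Real.exp (-2 * u) - 1) : ℂ) + z)).re =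
      Real.exp (u + z.re) * Real.cos (θ + u + z.im) := by
  rw [add_sub_cancel_left, Real.log_exp, ← Complex.exp_add, Complex.exp_re]
  have hh : (-(1 / 2) * (1 + I) : ℂ) = (((-(1 / 2) : ℝ)) : ℂ) + (((-(1 / 2) : ℝ)) : ℂ) * I := by
    push_cast; ring
  congr 1
  · congr 1
    rw [hh]
    simp only [add_re, mul_re, ofReal_re, ofReal_im, I_re, I_im, add_im, mul_im]
    ring
  · congr 1
    rw [hh]
    simp only [add_re, mul_re, ofReal_re, ofReal_im, I_re, I_im, add_im, mul_im]
    ring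

/-- **Sign changes of an oscillating main term** (the real-variable heart of Davenport–Heilbronn I,
Lemma 2: "for any `H > 0` we can find `s₁` and `s₂` such that `1 < s₁ < s₂ < 1 + δ` and
`ℜ(M(s₁)/a(l)) > H`, `ℜ(M(s₂)/a(l)) < −H` … Thus there is a value of `s` with `1 < s < 1 + δ` for
which `Z(s) = 0`"). Let `W` be real and continuous on `(1, 1+δ)` with
`|W(s) − 2ℜ(e^{iθ} e^{−½(1+i) log(s−1) + F(s)})| ≤ B` there, and `F(s) → c` as `s → 1⁺`. Then `W`
has a zero and a non-zero in `(1, 1+δ)`. (At `s = 1 + e^{−2u}` the main term is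
`2e^{u + ℜF} cos(θ + u + ℑF)`; take `u ≡ −θ − ℑc` and `u ≡ π − θ − ℑc (mod 2π)` large.)
[cite: DavenportHeilbronn1936a, §2 Lemma 2] -/
theorem exists_zero_of_logOsc {W : ℝ → ℝ} {F : ℝ → ℂ} {c : ℂ} (θ : ℝ) {δ B : ℝ} (hδ : 0 < δ)
    (hW : ContinuousOn W (Ioo 1 (1 + δ)))
    (hWE : ∀ s ∈ Ioo 1 (1 + δ),
      |W s - 2 * (cexp (θ * I) * cexp (-(1 / 2) * (1 + I) * (Real.log (s - 1) : ℂ) + F s)).re| ≤ B)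
    (hF : Tendsto F (𝓝[>] 1) (𝓝 c)) :
    (∃ s₁ ∈ Ioo 1 (1 + δ), W s₁ = 0) ∧ ∃ s₂ ∈ Ioo 1 (1 + δ), W s₂ ≠ 0 := by
  -- Step 1: `‖F s - c‖ < 1/2` on `(1, 1 + δ₂)`, `δ₂ ≤ δ`
  have hev : ∀ᶠ s in 𝓝[>] (1 : ℝ), ‖F s - c‖ < 1 / 2 := by
    have h := (Metric.tendsto_nhds.mp hF) (1 / 2) (by norm_num)
    exact h.mono fun s hs ↦ by rwa [dist_eq_norm] at hs
  obtain ⟨u₁, hu₁, hsub⟩ := mem_nhdsGT_iff_exists_Ioo_subset.mp hev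
  set δ₂ : ℝ := min δ (u₁ - 1) with hδ₂
  have hu₁' : 1 < u₁ := Set.mem_Ioi.1 hu₁
  have hδ₂0 : 0 < δ₂ := lt_min hδ (by linarith)
  have hδ₂δ : δ₂ ≤ δ := min_le_left _ _
  have hFs : ∀ s ∈ Ioo 1 (1 + δ₂), ‖F s - c‖ < 1 / 2 := fun s hs ↦
    hsub ⟨hs.1, lt_of_lt_of_le hs.2 (by linarith [min_le_right δ (u₁ - 1)])⟩
  -- `B ≥ 0` may be assumed (the interval is nonempty)
  have hB0 : 0 ≤ B := by
    have hmem : 1 + δ₂ / 2 ∈ Ioo 1 (1 + δ) := ⟨by linarith, by linarith⟩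
    exact (abs_nonneg _).trans (hWE _ hmem)
  -- Step 2: the points `s = 1 + e^{-2u}` and the estimates there
  set pt : ℝ → ℝ := fun u ↦ 1 + Real.exp (-2 * u) with hpt
  set L₁ : ℝ := -Real.log δ₂ / 2 with hL₁
  have hpt_mem : ∀ u : ℝ, L₁ < u → pt u ∈ Ioo 1 (1 + δ₂) := by
    intro u hu
    refine ⟨show (1 : ℝ) < 1 + Real.exp (-2 * u) by linarith [Real.exp_pos (-2 * u)], ?_⟩
    simp only [hpt, add_lt_add_iff_left]
    have h1 : -2 * u < Real.log δ₂ := by rw [hL₁] at hu; linarith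
    calc Real.exp (-2 * u) < Real.exp (Real.log δ₂) := Real.exp_lt_exp.2 h1
      _ = δ₂ := Real.exp_log hδ₂0
  have hmain : ∀ u : ℝ, L₁ < u →
      (cexp (θ * I) * cexp (-(1 / 2) * (1 + I) * (Real.log (pt u - 1) : ℂ) + F (pt u))).re =
        Real.exp (u + (F (pt u)).re) * Real.cos (θ + u + (F (pt u)).im) := fun u _ ↦
    re_model_at θ u (F (pt u))
  -- real and imaginary parts of `F` near `c`
  have hre : ∀ u : ℝ, L₁ < u → c.re - 1 / 2 ≤ (F (pt u)).re := by
    intro u hu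
    have h := hFs _ (hpt_mem u hu)
    have h1 : |(F (pt u) - c).re| ≤ ‖F (pt u) - c‖ := abs_re_le_norm _
    rw [sub_re] at h1
    linarith [(abs_le.1 (h1.trans h.le)).1]
  have him : ∀ u : ℝ, L₁ < u → |(F (pt u)).im - c.im| ≤ 1 / 2 := by
    intro u hu
    have h := hFs _ (hpt_mem u hu)
    have h1 : |(F (pt u) - c).im| ≤ ‖F (pt u) - c‖ := abs_im_le_norm _
    rw [sub_im] at h1
    exact h1.trans h.le
  -- Step 3: the choice of `k`
  set L₂ : ℝ := Real.log (B + 2) - c.re + 1 / 2 with hL₂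
  obtain ⟨k, hk⟩ := exists_nat_gt ((max L₁ L₂ + c.im + θ) / (2 * Real.pi))
  set u : ℝ := 2 * Real.pi * k - c.im - θ with hu
  have huL : max L₁ L₂ < u := by
    rw [div_lt_iff₀ (by positivity)] at hk
    rw [hu]; linarith
  have huL₁ : L₁ < u := lt_of_le_of_lt (le_max_left _ _) huL
  have huL₂ : L₂ < u := lt_of_le_of_lt (le_max_right _ _) huL
  have hu'L₁ : L₁ < u + Real.pi := by linarith [Real.pi_pos]
  have hu'L₂ : L₂ < u + Real.pi := by linarith [Real.pi_pos]
  -- the exponential factor dominates `B + 1`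
  have hexp : ∀ u' : ℝ, L₂ < u' → L₁ < u' → B + 1 < Real.exp (u' + (F (pt u')).re) := by
    intro u' hu'₂ hu'₁
    have h1 : Real.log (B + 2) < u' + (F (pt u')).re := by
      have := hre u' hu'₁
      rw [hL₂] at hu'₂
      linarith
    calc B + 1 < B + 2 := by linarith
      _ = Real.exp (Real.log (B + 2)) := (Real.exp_log (by linarith)).symm
      _ < Real.exp (u' + (F (pt u')).re) := Real.exp_lt_exp.2 h1
  -- Step 4: `W(pt u) > 0`
  have hpos : 0 < W (pt u) := by
    have hcos : 7 / 8 ≤ Real.cos (θ + u + (F (pt u)).im) := by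
      have : θ + u + (F (pt u)).im = ((F (pt u)).im - c.im) + (k : ℝ) * (2 * Real.pi) := by
        rw [hu]; ring
      rw [this, Real.cos_add_nat_mul_two_pi]
      exact cos_ge_of_abs_le_half (him u huL₁)
    have hWs := hWE _ ⟨(hpt_mem u huL₁).1, lt_of_lt_of_le (hpt_mem u huL₁).2 (by linarith)⟩
    rw [hmain u huL₁] at hWs
    have hE := hexp u huL₂ huL₁
    have hprod : B + 1 < 2 * (Real.exp (u + (F (pt u)).re) * Real.cos (θ + u + (F (pt u)).im)) := by
      have hpos' : 0 < Real.exp (u + (F (pt u)).re) := Real.exp_pos _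
      nlinarith
    linarith [(abs_le.1 hWs).1]
  -- Step 5: `W(pt (u + π)) < 0`
  have hneg : W (pt (u + Real.pi)) < 0 := by
    have hcos : Real.cos (θ + (u + Real.pi) + (F (pt (u + Real.pi))).im) ≤ -(7 / 8) := by
      have : θ + (u + Real.pi) + (F (pt (u + Real.pi))).im =
          (((F (pt (u + Real.pi))).im - c.im) + (k : ℝ) * (2 * Real.pi)) + Real.pi := by
        rw [hu]; ring
      rw [this, Real.cos_add_pi, Real.cos_add_nat_mul_two_pi]
      linarith [cos_ge_of_abs_le_half (him (u + Real.pi) hu'L₁)]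
    have hWs := hWE _ ⟨(hpt_mem _ hu'L₁).1, lt_of_lt_of_le (hpt_mem _ hu'L₁).2 (by linarith)⟩
    rw [hmain _ hu'L₁] at hWs
    have hE := hexp (u + Real.pi) hu'L₂ hu'L₁
    have hprod : 2 * (Real.exp ((u + Real.pi) + (F (pt (u + Real.pi))).re) *
        Real.cos (θ + (u + Real.pi) + (F (pt (u + Real.pi))).im)) < -(B + 1) := by
      have hpos' : 0 < Real.exp ((u + Real.pi) + (F (pt (u + Real.pi))).re) := Real.exp_pos _
      nlinarith
    linarith [(abs_le.1 hWs).2]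
  -- Step 6: the intermediate value theorem on `[pt (u + π), pt u]`
  have hlt : pt (u + Real.pi) < pt u := by
    simp only [hpt, add_lt_add_iff_left]
    exact Real.exp_lt_exp.2 (by linarith [Real.pi_pos])
  have hIcc : Icc (pt (u + Real.pi)) (pt u) ⊆ Ioo 1 (1 + δ) := fun s hs ↦
    ⟨lt_of_lt_of_le (hpt_mem _ hu'L₁).1 hs.1,
      lt_of_le_of_lt hs.2 (lt_of_lt_of_le (hpt_mem u huL₁).2 (by linarith))⟩
  have hivt := intermediate_value_Icc hlt.le (hW.mono hIcc)
  have h0 : (0 : ℝ) ∈ Icc (W (pt (u + Real.pi))) (W (pt u)) := ⟨hneg.le, hpos.le⟩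
  obtain ⟨s₁, hs₁, hWs₁⟩ := hivt h0
  exact ⟨⟨s₁, hIcc hs₁, hWs₁⟩, pt u, hIcc (right_mem_Icc.2 hlt.le), hpos.ne'⟩

/-! ## Conjugation of the logarithmic Euler series -/

variable {K : Type*} [Field K] [NumberField K]

/-- **`E_{conj a}(s) = conj E_a(s)`** for real `s ≥ 1` and `|a| ≤ 1` (termwise:
`−log(1 − conj z) = conj(−log(1 − z))` since `1 − z` has positive real part). [folklore] -/
theorem logEuler_conj {a : HeightOneSpectrum (𝓞 K) → ℂ} (ha : ∀ v, ‖a v‖ ≤ 1) {s : ℝ} (hs : 1 ≤ s) :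
    logEuler (fun v ↦ conj (a v)) s = conj (logEuler a s) := by
  unfold logEuler
  rw [Complex.conj_tsum]
  refine tsum_congr fun v ↦ ?_
  unfold logEulerTerm zterm
  have hz : ‖a v * (npow v s : ℂ)‖ ≤ 1 / 2 := norm_zterm_le_half ha hs v
  have hre : 0 < (1 - a v * (npow v s : ℂ)).re := by
    have h1 : |(a v * (npow v s : ℂ)).re| ≤ ‖a v * (npow v s : ℂ)‖ := abs_re_le_norm _
    simp only [sub_re, one_re]
    linarith [(abs_le.1 (h1.trans hz)).2]
  have harg : (1 - a v * (npow v s : ℂ)).arg ≠ Real.pi := by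
    rw [Ne, Complex.arg_eq_pi_iff, not_and_or]
    left
    exact not_lt.2 hre.le
  rw [map_neg, ← Complex.log_conj _ harg, map_sub, map_one, map_mul, Complex.conj_ofReal]

/-! ## The degree-one part of `E_χ` for the genus twist -/

/-- `a_χ(𝔭) = χ([𝔭])` for the modulus `(1)`. [folklore] -/
theorem charCoeff_top (χ : AddChar (Additive (ClassGroup (𝓞 K))) ℂ) (v : HeightOneSpectrum (𝓞 K)) :
    charCoeff ⊤ (primeClass (K := K)) χ v = toMulHom χ (primeClass v) := by
  rw [charCoeff_apply, if_neg (not_top_le v)]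

/-- **Pointwise decomposition of the twisted degree-one terms**: for the genus twist,
`[N𝔭 prime] χ([𝔭]) a(N𝔭) N𝔭^{-s} = ½(1+i)·[N𝔭 prime] χ([𝔭]) N𝔭^{-s} + ½(1−i)·[N𝔭 prime] (χ+χ₁)([𝔭]) N𝔭^{-s}`
(D–H I §2 Lemma 1, proof). [cite: DavenportHeilbronn1936a, §2 Lemma 1] -/
theorem primeTerm_twistCoeff (h2 : finrank ℚ K = 2) {χ₁ : AddChar (Additive (ClassGroup (𝓞 K))) ℂ}
    (hreal : ∀ g, toMulHom χ₁ g = 1 ∨ toMulHom χ₁ g = -1) {a : ℕ →* ℂ}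
    (ha : ∀ p : ℕ, p.Prime → a p = if (∃ v : HeightOneSpectrum (𝓞 K),
      Ideal.absNorm v.asIdeal = p ∧ toMulHom χ₁ (primeClass v) = -1) then I else 1)
    (χ : AddChar (Additive (ClassGroup (𝓞 K))) ℂ) (s : ℝ) (v : HeightOneSpectrum (𝓞 K)) :
    primeTerm (twistCoeff χ a) s v =
      (1 + I) / 2 * primeTerm (charCoeff ⊤ (primeClass (K := K)) χ) s v +
        (1 - I) / 2 * primeTerm (charCoeff ⊤ (primeClass (K := K)) (χ + χ₁)) s v := by
  unfold primeTerm
  by_cases hp : (Ideal.absNorm v.asIdeal).Prime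
  · simp only [if_pos hp]
    unfold zterm twistCoeff
    rw [charCoeff_top, charCoeff_top, IsDHGenusTwist.apply_absNorm_eq_of_prime h2 hreal ha hp,
      toMulHom_apply, toMulHom_apply, toMulHom_apply, AddChar.add_apply]
    ring
  · simp only [if_neg hp, mul_zero, add_zero]

/-- **`D^{tw}_χ(s) = ½(1+i) D_χ(s) + ½(1−i) D_{χ+χ₁}(s)`** (`s > 1`): the degree-one part of `E_χ` for
the genus twist in terms of the untwisted class-character prime sums. [cite: DavenportHeilbronn1936a, §2 Lemma 1] -/
theorem tsum_primeTerm_twistCoeff (h2 : finrank ℚ K = 2) {χ₁ : AddChar (Additive (ClassGroup (𝓞 K))) ℂ}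
    (hreal : ∀ g, toMulHom χ₁ g = 1 ∨ toMulHom χ₁ g = -1) {a : ℕ →* ℂ}
    (ha : ∀ p : ℕ, p.Prime → a p = if (∃ v : HeightOneSpectrum (𝓞 K),
      Ideal.absNorm v.asIdeal = p ∧ toMulHom χ₁ (primeClass v) = -1) then I else 1)
    (χ : AddChar (Additive (ClassGroup (𝓞 K))) ℂ) {s : ℝ} (hs : 1 < s) :
    ∑' v, primeTerm (twistCoeff χ a) s v =
      (1 + I) / 2 * ∑' v, primeTerm (charCoeff ⊤ (primeClass (K := K)) χ) s v +
        (1 - I) / 2 * ∑' v, primeTerm (charCoeff ⊤ (primeClass (K := K)) (χ + χ₁)) s v := by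
  have h1 := summable_primeTerm (norm_charCoeff_le ⊤ (primeClass (K := K)) χ) hs
  have h2' := summable_primeTerm (norm_charCoeff_le ⊤ (primeClass (K := K)) (χ + χ₁)) hs
  rw [← tsum_mul_left, ← tsum_mul_left, ← (h1.mul_left _).tsum_add (h2'.mul_left _)]
  exact tsum_congr fun v ↦ primeTerm_twistCoeff h2 hreal ha χ s v

/-! ## The real zero of the twisted model (D–H I, Lemma 2) -/

/-- **A real zero of the twisted model for a real non-principal class character** (Davenport–Heilbronn
I, Lemmas 1–2 and §4). Let `K` be an imaginary quadratic field with `d_K < −4`, `(1, ω)` an integral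
basis with `ω² = m + tω`, `𝔟 = (A, ω − k)` the lattice ideal of the form `Q = (A, t − 2k, C)`
(`A > 0`, `AC = k² − tk − m`), `χ₁` a real non-principal character of `Cl(K)` and `a` its genus twist.
Then `Z_a(s) = Σ'_v a(Q(v)) Q(v)^{-s}` vanishes at some real `s₁ > 1` and does not vanish at some real
`s₂ > 1`. [cite: DavenportHeilbronn1936a, §2 Lemma 2 and §4] -/
theorem exists_real_zero_twistModel_of_real_addChar (h2 : finrank ℚ K = 2)
    (b : Basis (Fin 2) ℤ (𝓞 K)) (hb : b 0 = 1)
    {t m : ℤ} (hω : b 1 * b 1 = (m : 𝓞 K) + (t : 𝓞 K) * b 1) (hD : t ^ 2 + 4 * m < -4)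
    {A k C : ℤ} (hA : 0 < A) (hn : A * C = k ^ 2 - t * k - m)
    {χ₁ : AddChar (Additive (ClassGroup (𝓞 K))) ℂ} (hχ₁ : χ₁ ≠ 0)
    (hreal : ∀ g, toMulHom χ₁ g = 1 ∨ toMulHom χ₁ g = -1) {a : ℕ →* ℂ}
    (ha : ∀ p : ℕ, p.Prime → a p = if (∃ v : HeightOneSpectrum (𝓞 K),
      Ideal.absNorm v.asIdeal = p ∧ toMulHom χ₁ (primeClass v) = -1) then I else 1) :
    (∃ s₁ : ℝ, 1 < s₁ ∧ twistModel a A (t - 2 * k) C (s₁ : ℂ) = 0) ∧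
      ∃ s₂ : ℝ, 1 < s₂ ∧ twistModel a A (t - 2 * k) C (s₂ : ℂ) ≠ 0 := by
  -- notation
  set G := ClassGroup (𝓞 K)
  set 𝔟 : Ideal (𝓞 K) := Ideal.span {(A : 𝓞 K), b 1 - k} with h𝔟
  set cls : AddChar (Additive G) ℂ → ℂ := fun χ ↦ toMulHom χ (idealClass 𝔟) with hcls
  set E : AddChar (Additive G) ℂ → ℝ → ℂ := fun χ s ↦ logEuler (twistCoeff χ a) s with hE
  set P : ℝ → ℂ := fun s ↦ ∑ χ : AddChar (Additive G) ℂ, cls χ * cexp (E χ s) with hP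
  have ha1 : ∀ n, ‖a n‖ ≤ 1 := norm_map_le_one a (IsDHGenusTwist.norm_apply_prime ha)
  have haχ : ∀ (χ : AddChar (Additive G) ℂ) v, ‖twistCoeff χ a v‖ ≤ 1 := fun χ v ↦ norm_twistCoeff_le χ ha1 v
  have hcard : (Nat.card G : ℂ) ≠ 0 := Nat.cast_ne_zero.mpr Nat.card_pos.ne'
  -- the bridge: `Z_a(s) = (2/h) P(s)`
  have hbridge : ∀ s : ℝ, 1 < s → twistModel a A (t - 2 * k) C (s : ℂ) = (2 / (Nat.card G : ℂ)) * P s :=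
    fun s hs ↦ twistModel_eq_sum_addChar b hb hω hD hA hn a ha1 hs
  -- Step 1: conjugation symmetry `conj E_χ = E_{χ₁ - χ}` and `conj P = χ₁([𝔟]) P`
  have hconjE : ∀ (χ : AddChar (Additive G) ℂ) (s : ℝ), 1 ≤ s → conj (E χ s) = E (χ₁ - χ) s := by
    intro χ s hs
    rw [hE]
    dsimp only
    rw [← logEuler_conj (haχ χ) hs]
    congr 1
    funext v
    exact IsDHGenusTwist.conj_twistCoeff h2 hreal ha χ v
  set ε : ℂ := toMulHom χ₁ (idealClass 𝔟) with hε
  have hε1 : ε = 1 ∨ ε = -1 := hreal _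
  have hεε : ε * ε = 1 := toMulHom_mul_self_of_real hreal _
  have hεinv : ε⁻¹ = ε := inv_eq_of_mul_eq_one_right hεε
  have hεconj : conj ε = ε := by rcases hε1 with h | h <;> rw [h] <;> simp
  have hcls_sub : ∀ χ : AddChar (Additive G) ℂ, toMulHom (χ - χ₁) (idealClass 𝔟) = cls χ * ε := by
    intro χ
    rw [hcls]
    dsimp only
    rw [toMulHom_apply, toMulHom_apply, AddChar.sub_apply, AddChar.map_neg_eq_inv, ← toMulHom_apply χ₁,
      ← hε, hεinv]
  have hconjP : ∀ s : ℝ, 1 ≤ s → conj (P s) = ε * P s := by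
    intro s hs
    rw [hP]
    dsimp only
    rw [map_sum, Finset.mul_sum, ← Equiv.sum_comp (Equiv.subLeft χ₁)]
    refine Finset.sum_congr rfl fun χ _ ↦ ?_
    rw [Equiv.subLeft_apply, map_mul, ← Complex.exp_conj, hconjE _ s hs, sub_sub_cancel, hcls]
    dsimp only
    rw [conj_toMulHom, neg_sub, hcls_sub χ]
    ring
  -- Step 2: the unit `η` with `η² = ε`, making `η P` real
  set η : ℂ := if ε = 1 then 1 else I with hη
  set θ : ℝ := if ε = 1 then 0 else Real.pi / 2 with hθ
  have hηθ : cexp (θ * I) = η := by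
    by_cases h : ε = 1
    · simp [hη, hθ, h]
    · simp only [hη, hθ, if_neg h]
      rw [Complex.exp_mul_I, ← Complex.ofReal_cos, ← Complex.ofReal_sin, Real.cos_pi_div_two,
        Real.sin_pi_div_two]
      simp
  have hηε : conj η * ε = η := by
    by_cases h : ε = 1
    · simp [hη, h]
    · have h' : ε = -1 := hε1.resolve_left h
      simp only [hη, if_neg h]
      rw [h', Complex.conj_I]; ring
  have hη0 : η ≠ 0 := by
    by_cases h : ε = 1
    · simp [hη, h]
    · simp only [hη, if_neg h]; exact Complex.I_ne_zero
  have hreal_ηP : ∀ s : ℝ, 1 ≤ s → (η * P s).im = 0 := by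
    intro s hs
    rw [← Complex.conj_eq_iff_im, map_mul, hconjP s hs, ← mul_assoc, hηε]
  -- Step 3: splitting off `χ = 0` and `χ = χ₁`
  set S' : Finset (AddChar (Additive G) ℂ) := (Finset.univ.erase 0).erase χ₁ with hS'
  set Bf : ℝ → ℂ := fun s ↦ ∑ χ ∈ S', cls χ * cexp (E χ s) with hBf
  have hcls0 : cls 0 = 1 := by
    rw [hcls]; dsimp only; rw [toMulHom_apply, AddChar.zero_apply]
  have hclsχ₁ : cls χ₁ = ε := rfl
  have hPsplit : ∀ s : ℝ, P s = cexp (E 0 s) + ε * cexp (E χ₁ s) + Bf s := by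
    intro s
    rw [hP, hBf]
    dsimp only
    have hχ₁mem : χ₁ ∈ Finset.univ.erase (0 : AddChar (Additive G) ℂ) :=
      Finset.mem_erase.2 ⟨hχ₁, Finset.mem_univ _⟩
    rw [← Finset.add_sum_erase _ _ (Finset.mem_univ (0 : AddChar (Additive G) ℂ)),
      ← Finset.add_sum_erase _ _ hχ₁mem, hcls0, one_mul]
    ring
  have hEχ₁ : ∀ s : ℝ, 1 ≤ s → E χ₁ s = conj (E 0 s) := by
    intro s hs
    rw [hconjE 0 s hs, sub_zero]
  have hW_eq : ∀ s : ℝ, 1 ≤ s → (η * P s).re = 2 * (η * cexp (E 0 s)).re + (η * Bf s).re := by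
    intro s hs
    rw [hPsplit s, hEχ₁ s hs, Complex.exp_conj]
    have hmid : (η * (ε * conj (cexp (E 0 s)))).re = (η * cexp (E 0 s)).re := by
      have : η * (ε * conj (cexp (E 0 s))) = conj (conj η * ε * cexp (E 0 s)) := by
        rw [map_mul, map_mul, Complex.conj_conj, hεconj]; ring
      rw [this, Complex.conj_re, hηε]
    rw [mul_add, mul_add, add_re, add_re, hmid]
    ring
  -- Step 4: limits of the `E_χ`
  set D : AddChar (Additive G) ℂ → ℝ → ℂ := fun χ s ↦ ∑' v, primeTerm (charCoeff ⊤ (primeClass (K := K)) χ) s v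
    with hDdef
  set R : AddChar (Additive G) ℂ → ℝ → ℂ := fun χ s ↦ ∑' v, remTerm (twistCoeff χ a) s v with hRdef
  have hEeq : ∀ (χ : AddChar (Additive G) ℂ) (s : ℝ), 1 < s →
      E χ s = (1 + I) / 2 * D χ s + (1 - I) / 2 * D (χ + χ₁) s + R χ s := by
    intro χ s hs
    rw [hE]
    dsimp only
    rw [logEuler_eq_add (haχ χ) hs, tsum_primeTerm_twistCoeff h2 hreal ha χ hs]
  have hRt : ∀ χ : AddChar (Additive G) ℂ, Tendsto (R χ) (𝓝[>] 1) (𝓝 (R χ 1)) := fun χ ↦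
    tendsto_tsum_remTerm (haχ χ)
  -- `χ ∈ S'`: `E_χ` converges
  have hElim : ∀ χ ∈ S', ∃ e : ℂ, Tendsto (E χ) (𝓝[>] 1) (𝓝 e) := by
    intro χ hχ
    have hχ0 : χ ≠ 0 := Finset.ne_of_mem_erase (Finset.mem_of_mem_erase hχ)
    have hχχ₁ : χ ≠ χ₁ := Finset.ne_of_mem_erase hχ
    have hsum0 : χ + χ₁ ≠ 0 := by
      intro h0
      apply hχχ₁
      have : χ = -χ₁ := eq_neg_of_add_eq_zero_left h0
      rw [this, neg_eq_self_of_real hreal]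
    obtain ⟨d₁, hd₁⟩ := tendsto_charPrimeSum χ hχ0
    obtain ⟨d₂, hd₂⟩ := tendsto_charPrimeSum (χ + χ₁) hsum0
    refine ⟨(1 + I) / 2 * d₁ + (1 - I) / 2 * d₂ + R χ 1, ?_⟩
    refine (((hd₁.const_mul _).add (hd₂.const_mul _)).add (hRt χ)).congr' ?_
    filter_upwards [self_mem_nhdsWithin] with s hs
    exact (hEeq χ s hs).symm
  choose! eχ heχ using hElim
  -- `χ = 0`: `E_0(s) = -½(1+i) log(s-1) + F₀(s)`, `F₀ → c₀`
  obtain ⟨L₀, hL₀⟩ := tendsto_charPrimeSum_zero_add_log (K := K)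
  obtain ⟨d₁, hd₁⟩ := tendsto_charPrimeSum χ₁ hχ₁
  set F₀ : ℝ → ℂ := fun s ↦ E 0 s + (1 / 2) * (1 + I) * (Real.log (s - 1) : ℂ) with hF₀
  have hF₀t : Tendsto F₀ (𝓝[>] 1) (𝓝 ((1 + I) / 2 * (L₀ : ℂ) + (1 - I) / 2 * d₁ + R 0 1)) := by
    refine (((hL₀.const_mul ((1 + I) / 2)).add (hd₁.const_mul ((1 - I) / 2))).add (hRt 0)).congr' ?_
    filter_upwards [self_mem_nhdsWithin] with s hs
    rw [hF₀]
    dsimp only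
    rw [hEeq 0 s hs, zero_add]
    ring
  have hE0 : ∀ s : ℝ, E 0 s = -(1 / 2) * (1 + I) * (Real.log (s - 1) : ℂ) + F₀ s := by
    intro s; simp only [hF₀]; ring
  -- Step 5: a common interval `(1, 1 + δ₀)` where the `E_χ`, `χ ∈ S'`, are within `1` of their limits
  have hnear : ∀ χ ∈ S', ∀ᶠ s : ℝ in 𝓝[>] 1, ‖E χ s - eχ χ‖ < 1 := by
    intro χ hχ
    have h := (Metric.tendsto_nhds.mp (heχ χ hχ)) 1 one_pos
    exact h.mono fun s hs ↦ by rwa [dist_eq_norm] at hs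
  have hall : ∀ᶠ s : ℝ in 𝓝[>] 1, ∀ χ ∈ S', ‖E χ s - eχ χ‖ < 1 :=
    (Filter.eventually_all_finset S').mpr hnear
  obtain ⟨u₀, hu₀, hsub⟩ := mem_nhdsGT_iff_exists_Ioo_subset.mp hall
  set δ₀ : ℝ := u₀ - 1 with hδ₀
  have hδ₀0 : 0 < δ₀ := by have := Set.mem_Ioi.1 hu₀; rw [hδ₀]; linarith
  set B₀ : ℝ := ∑ χ ∈ S', Real.exp ((eχ χ).re + 1) with hB₀
  have hBbound : ∀ s ∈ Ioo 1 (1 + δ₀), ‖Bf s‖ ≤ B₀ := by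
    intro s hs
    have hs' : s ∈ Ioo 1 u₀ := ⟨hs.1, by rw [hδ₀] at hs; linarith [hs.2]⟩
    have hχs := hsub hs'
    rw [hBf]
    dsimp only
    refine (norm_sum_le _ _).trans (Finset.sum_le_sum fun χ hχ ↦ ?_)
    rw [norm_mul, hcls]
    dsimp only
    rw [norm_toMulHom, one_mul, Complex.norm_exp]
    refine Real.exp_le_exp.2 ?_
    have h1 : |(E χ s - eχ χ).re| ≤ ‖E χ s - eχ χ‖ := abs_re_le_norm _
    rw [sub_re] at h1
    linarith [(abs_le.1 (h1.trans (hχs χ hχ).le)).2]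
  -- Step 6: the real function `W = ℜ(η P)` and the oscillation lemma
  set W : ℝ → ℝ := fun s ↦ (η * P s).re with hWdef
  have hEcont : ∀ χ : AddChar (Additive G) ℂ, ContinuousOn (E χ) (Ioi 1) := fun χ ↦
    continuousOn_logEuler (haχ χ)
  have hPcont : ContinuousOn P (Ioi 1) := by
    rw [hP]
    exact continuousOn_finsetSum _ fun χ _ ↦ continuousOn_const.mul ((hEcont χ).cexp)
  have hWcont : ContinuousOn W (Ioo 1 (1 + δ₀)) :=
    (Complex.continuous_re.comp_continuousOn (continuousOn_const.mul hPcont)).mono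
      fun s hs ↦ mem_Ioi.2 hs.1
  have hWE : ∀ s ∈ Ioo 1 (1 + δ₀),
      |W s - 2 * (cexp (θ * I) * cexp (-(1 / 2) * (1 + I) * (Real.log (s - 1) : ℂ) + F₀ s)).re| ≤ B₀ := by
    intro s hs
    rw [hηθ, ← hE0 s, hWdef]
    dsimp only
    rw [hW_eq s hs.1.le, add_sub_cancel_left]
    calc |(η * Bf s).re| ≤ ‖η * Bf s‖ := abs_re_le_norm _
      _ = ‖Bf s‖ := by
          rw [norm_mul]
          have : ‖η‖ = 1 := by rw [← hηθ, Complex.norm_exp_ofReal_mul_I]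
          rw [this, one_mul]
      _ ≤ B₀ := hBbound s hs
  obtain ⟨⟨s₁, hs₁, hW₁⟩, s₂, hs₂, hW₂⟩ := exists_zero_of_logOsc θ hδ₀0 hWcont hWE hF₀t
  -- Step 7: conclusion
  have hP₁ : P s₁ = 0 := by
    have h1 : η * P s₁ = 0 := Complex.ext (by simpa [hWdef] using hW₁) (by
      rw [hreal_ηP s₁ hs₁.1.le]; rfl)
    exact (mul_eq_zero.1 h1).resolve_left hη0
  have hP₂ : P s₂ ≠ 0 := by
    intro h0
    apply hW₂
    simp [hWdef, h0]
  refine ⟨⟨s₁, hs₁.1, ?_⟩, s₂, hs₂.1, ?_⟩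
  · rw [hbridge s₁ hs₁.1, hP₁, mul_zero]
  · rw [hbridge s₂ hs₂.1]
    exact mul_ne_zero (div_ne_zero two_ne_zero hcard) hP₂

/-- **Davenport–Heilbronn I, Theorem 3 (with Titchmarsh's `≫ T` count), for the form of a lattice
ideal.** Under the hypotheses of `exists_real_zero_twistModel_of_real_addChar` (imaginary quadratic
`K`, `d_K < −4`, `𝔟 = (A, ω − k)`, a real non-principal character `χ₁` of `Cl(K)` — which exists iff
`h(d)` is even — and its genus twist `a`), the Epstein zeta function of `Q = (A, t − 2k, C)` has
infinitely many zeros in `σ > 1`, at least `C·T` of them with `0 < t ≤ T` for all large `T`: the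
conclusion of `DavenportHeilbronn1936b_epstein` for `Q`. [cite: DavenportHeilbronn1936a, §4 Theorem 3]
[cite: Titchmarsh1986, §10.25] -/
theorem davenportHeilbronn_conclusion_of_real_addChar (h2 : finrank ℚ K = 2)
    (b : Basis (Fin 2) ℤ (𝓞 K)) (hb : b 0 = 1)
    {t m : ℤ} (hω : b 1 * b 1 = (m : 𝓞 K) + (t : 𝓞 K) * b 1) (hD : t ^ 2 + 4 * m < -4)
    {A k C : ℤ} (hA : 0 < A) (hn : A * C = k ^ 2 - t * k - m)
    {χ₁ : AddChar (Additive (ClassGroup (𝓞 K))) ℂ} (hχ₁ : χ₁ ≠ 0)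
    (hreal : ∀ g, toMulHom χ₁ g = 1 ∨ toMulHom χ₁ g = -1) {a : ℕ →* ℂ}
    (ha : ∀ p : ℕ, p.Prime → a p = if (∃ v : HeightOneSpectrum (𝓞 K),
      Ideal.absNorm v.asIdeal = p ∧ toMulHom χ₁ (primeClass v) = -1) then I else 1) :
    {s : ℂ | 1 < s.re ∧ epsteinZeta (A : ℝ) ((t - 2 * k : ℤ) : ℝ) (C : ℝ) s = 0}.Infinite ∧
      ∃ C' : ℝ, 0 < C' ∧ ∀ᶠ T : ℝ in atTop,
        C' * T ≤ ({s : ℂ | 1 < s.re ∧ 0 < s.im ∧ s.im ≤ T ∧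
          epsteinZeta (A : ℝ) ((t - 2 * k : ℤ) : ℝ) (C : ℝ) s = 0}.ncard : ℝ) := by
  have hpos : IsPosDefForm (A : ℝ) ((t - 2 * k : ℤ) : ℝ) (C : ℝ) := isPosDefForm_lattice (by linarith) hA hn
  obtain ⟨⟨s₁, hs₁, hz⟩, s₂, hs₂, hnz⟩ :=
    exists_real_zero_twistModel_of_real_addChar h2 b hb hω hD hA hn hχ₁ hreal ha
  exact davenportHeilbronn_conclusion_of_twist_zero hpos a (IsDHGenusTwist.norm_apply_prime ha)
    (by simpa using hs₁) hz (by simpa using hs₂) hnz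

end DHEpstein

end Literature.Barriers.RiemannHypothesis
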